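/-
Origin: expansion seat `planner-pub-hodgecm-pohl-g7-0`, handover #1(3)v3 2026-08-18T07:02:57Z (`HOME/pub-hodgecm-pohl-g7/lean/Pohl7/ToyKillH0.lean`, md5 36491b69, 197 lines);
landed by the gen-7 packager in gate run 25 as `HodgeCM/Model/Toy/KillH0.lean` (import ^import Pohl7\.KillH0Descent\b→import HodgeCM.Model.KillH0Descent ×1).
-/
/-
Copyright: pub-hodgecm formalisation cell (harness21, 2026). New file (not vendored).
Origin: HOME/pub-hodgecm-pohl-g7/lean/Pohl7/ToyKillH0.lean — session planner-pub-hodgecm-pohl-g7-0 (unit pub-hodgecm-pohl-g7),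
EXPANSION part (b) `PohlmannSpan`, generation 7.  Intended final place: `HodgeCM/Model/Toy/KillH0.lean`
(module `HodgeCM.Model.Toy.KillH0`; the import `Pohl7.KillH0Descent` becomes `HodgeCM.Model.KillH0Descent`).
-/
import Summits.HodgeConjecture.HodgeCM.Model.KillH0Descent
import Summits.HodgeConjecture.HodgeCM.Model.Toy.ToyGysinDescent
import Summits.HodgeConjecture.HodgeCM.Model.ToyPerL

/-!
# The `H⁰`-free exterior universe `toyModel.killH0`: independence of the degree-`0` input

The universe transform `killH0` (`HodgeCM.Model.KillH0`) applied to the exterior toy universe `toyModel`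
(`HodgeCM.Model.Toy.Toy`; `H^k = ⋀^k L`, all traces `0`) gives a universe `toyModel♭` with

* `ModelAxioms` (all 28 fields), N1 `Fact_cupExterior`, N2 `Fact_cup_hodge`, N3 `Fact_pull_H0`, N4 `Fact_hodge_F0`,
  F4 `Fact_cupAlg`, F5 `Fact_cupAssoc`, F7d `Fact_gysinDescent`, `Fact_dimProd` — the COMPLETE generic hypothesis list of
  the trace-free headline theorems `Universe.qw8Sufficiency_of_descentFacts` / `Universe.qw8Milne_of_descentFacts` /
  `Assembly.COR_CM_of_descentFacts` (whose only other binder is the realisation input) — all THEOREMS here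
  (`killH0_descentFacts`), the two transform hypotheses `H0Rigid` (`⋀⁰ f = ⋀⁰ g`: both the identity of `⋀⁰ = ℚ`) and
  `TrZero` (`tr := 0`) of `toyModel` being checked by `toyModel_h0Rigid`, `toyModel_trZero`;
* `H⁰(X) = 0` for EVERY variety `X`; consequently `Fact_H0_rank`, `CMProdH0Nontrivial`, `CMProdConnected`, F6
  `Fact_weightDual` and `PohlmannTheorem31All` (Gao–Ullmo Thm 3.1 incl. `p = 0`) are all FALSE in `toyModel♭`
  (`killH0_degreeZero_fails`), no family of degree-`0` classes satisfies the unit law `1 ∪ z = z` (`killH0_not_unitLaw`;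
  so qw8-g4's unit-class fact F-H0 fails too), while `PohlmannSpan`, `Qw8Sufficiency`, `Qw8Milne` HOLD in it (`killH0_positive`)
  and so does COR-CM `HC_CM` (`killH0_hc_cm`, transferred from `toyModel_hc_cm`) — `degreeZero_orthogonal`: the degree-`0` input is
  orthogonal to HC.

MAIN RESULT `degreeZero_independent` / `cmProdH0Nontrivial_not_derivable`: the degree-`0` input of the all-`p` Pohlmann
theorem — in any of its forms `Fact_H0_rank` (pohl-g6), `CMProdConnected` (pohl-g4), `CMProdH0Nontrivial` (pohl-g6, the
weakest) — is NOT a consequence of `ModelAxioms` + N1–N4 + F4 + F5 + F7d + `Fact_dimProd`.  This settles the question recorded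
as open in `HodgeCM.Proofs.Pohlmann.DegreeZeroGeneric` (pohl-g6): with the monomial-basis facts F7 + `Fact_trTopCM` the
input IS derivable (`cmProdConnected_of_generic`), with the trace-free F7d it is NOT; and `Fact_trTopCM` itself fails in every
exterior retrace (`HodgeCM.Model.Toy.TrTop`).  So in the trace-free cone the degree-`0` statement must remain a SEPARATELY
CITED classical fact (connectedness of abelian varieties: Mumford, *Abelian Varieties* §1; Lange (2023) §1.1.4) — exactly as
FACTS.md row N3/`Fact_H0_rank` has it — and cannot be absorbed into the other rows.

KERNEL-PROVED throughout (Lean + Mathlib axioms only); nothing cited, no hypothesis named after PerL / [QW8] / the 2001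
programme; the words "toy"/"model" refer to the exterior universe of `HodgeCM.Model.Toy`, a consistency witness, never to
the intended geometric model.
-/

noncomputable section

open scoped TensorProduct

namespace HodgeCM.Toy

open exteriorPower

/-! ## 1. The two transform hypotheses hold in the exterior universe -/

/-- `⋀⁰ f = ⋀⁰ g` for ANY two linear maps `f, g : M → N` (`⋀⁰` is spanned by the empty product, on which both give
the empty product). -/
theorem exteriorPower_map_zero_eq {R : Type*} [CommRing R] {M N : Type*} [AddCommGroup M] [Module R M]
    [AddCommGroup N] [Module R N] (f g : M →ₗ[R] N) : map 0 f = map 0 g := by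
  refine LinearMap.ext_on_range (ιMulti_span R 0 M) fun a => ?_
  rw [map_apply_ιMulti, map_apply_ιMulti]
  congr 1
  funext i
  exact i.elim0

/-- `H0Rigid` in every exterior universe `toyModelWith D`. -/
theorem h0Rigid (D : HodgeData) : (toyModelWith D).H0Rigid := fun _ _ f g => exteriorPower_map_zero_eq f.lin g.lin

/-- `TrZero` in every exterior universe (`tr := 0` by definition). -/
theorem trZero (D : HodgeData) : (toyModelWith D).TrZero := fun _ _ => rfl

/-- (Ported verbatim from the HodgeCMPerL package; no docstring in the source.) -/
theorem toyModel_h0Rigid : toyModel.H0Rigid := h0Rigid exteriorHodgeData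

/-- (Ported verbatim from the HodgeCMPerL package; no docstring in the source.) -/
theorem toyModel_trZero : toyModel.TrZero := trZero exteriorHodgeData

/-! ## 2. `toyModel♭ := toyModel.killH0` satisfies the complete trace-free generic hypothesis list -/

/-- (Ported verbatim from the HodgeCMPerL package; no docstring in the source.) -/
theorem killH0_modelAxioms : toyModel.killH0.ModelAxioms :=
  Universe.KillH0.modelAxioms toyModel_modelAxioms toyModel_h0Rigid toyModel_trZero toyModel_fact_dimProd

/-- (Ported verbatim from the HodgeCMPerL package; no docstring in the source.) -/
theorem killH0_fact_cupExterior : toyModel.killH0.Fact_cupExterior :=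
  Universe.KillH0.fact_cupExterior toyModel_fact_cupExterior

/-- (Ported verbatim from the HodgeCMPerL package; no docstring in the source.) -/
theorem killH0_fact_cup_hodge : toyModel.killH0.Fact_cup_hodge :=
  Universe.KillH0.fact_cup_hodge toyModel_fact_cup_hodge

/-- (Ported verbatim from the HodgeCMPerL package; no docstring in the source.) -/
theorem killH0_fact_pull_H0 : toyModel.killH0.Fact_pull_H0 := Universe.KillH0.fact_pull_H0

/-- (Ported verbatim from the HodgeCMPerL package; no docstring in the source.) -/
theorem killH0_fact_hodge_F0 : toyModel.killH0.Fact_hodge_F0 :=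
  Universe.KillH0.fact_hodge_F0 toyModel_fact_hodge_F0

/-- (Ported verbatim from the HodgeCMPerL package; no docstring in the source.) -/
theorem killH0_fact_cupAlg : toyModel.killH0.Fact_cupAlg := Universe.KillH0.fact_cupAlg fact_cupAlg

/-- (Ported verbatim from the HodgeCMPerL package; no docstring in the source.) -/
theorem killH0_fact_cupAssoc : toyModel.killH0.Fact_cupAssoc :=
  Universe.KillH0.fact_cupAssoc (fact_cupAssoc exteriorHodgeData)

/-- (Ported verbatim from the HodgeCMPerL package; no docstring in the source.) -/
theorem killH0_fact_gysinDescent : toyModel.killH0.Fact_gysinDescent :=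
  Universe.KillH0.fact_gysinDescent toyModel_modelAxioms.pull_comp toyModel_h0Rigid toyModel_fact_gysinDescent

/-- (Ported verbatim from the HodgeCMPerL package; no docstring in the source.) -/
theorem killH0_fact_dimProd : toyModel.killH0.Fact_dimProd :=
  Universe.KillH0.fact_dimProd_iff.mpr toyModel_fact_dimProd

/-- All nine generic binders of `Assembly.COR_CM_of_descentFacts` hold in `toyModel♭`. -/
theorem killH0_descentFacts :
    toyModel.killH0.ModelAxioms ∧ toyModel.killH0.Fact_cupExterior ∧ toyModel.killH0.Fact_cup_hodge ∧
      toyModel.killH0.Fact_pull_H0 ∧ toyModel.killH0.Fact_hodge_F0 ∧ toyModel.killH0.Fact_cupAlg ∧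
      toyModel.killH0.Fact_cupAssoc ∧ toyModel.killH0.Fact_gysinDescent ∧ toyModel.killH0.Fact_dimProd :=
  ⟨killH0_modelAxioms, killH0_fact_cupExterior, killH0_fact_cup_hodge, killH0_fact_pull_H0, killH0_fact_hodge_F0,
    killH0_fact_cupAlg, killH0_fact_cupAssoc, killH0_fact_gysinDescent, killH0_fact_dimProd⟩

/-! ## 3. … and refutes every form of the degree-`0` input -/

/-- `H⁰(X) = 0` for every variety of `toyModel♭`. -/
theorem killH0_finrank_coh_zero (X : toyModel.Var) : Module.finrank ℚ (toyModel.killH0.Coh X 0) = 0 :=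
  Universe.KillH0.finrank_coh_zero X

/-- (Ported verbatim from the HodgeCMPerL package; no docstring in the source.) -/
theorem killH0_degreeZero_fails :
    ¬ toyModel.killH0.Fact_H0_rank ∧ ¬ toyModel.killH0.CMProdH0Nontrivial ∧ ¬ toyModel.killH0.CMProdConnected ∧
      ¬ toyModel.killH0.Fact_weightDual ∧ ¬ toyModel.killH0.PohlmannTheorem31All :=
  ⟨Universe.KillH0.not_fact_H0_rank, Universe.KillH0.not_cmProdH0Nontrivial, Universe.KillH0.not_cmProdConnected,
    Universe.KillH0.not_fact_weightDual killH0_modelAxioms killH0_fact_cupExterior,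
    Universe.KillH0.not_pohlmannTheorem31All⟩

/-- No family of degree-`0` classes of `toyModel♭` satisfies the unit law `1_X ∪ z = z` (clause (ii) of F-H0). -/
theorem killH0_not_unitLaw :
    ¬ ∃ one : ∀ X : toyModel.killH0.Var, toyModel.killH0.Coh X 0,
      ∀ (X : toyModel.killH0.Var) (l : ℕ) (z : toyModel.killH0.Coh X l),
        toyModel.killH0.cup X 0 l (one X) z = toyModel.killH0.castCoh X (Nat.zero_add l).symm z :=
  Universe.KillH0.not_unitLaw toyModel_modelAxioms.H1_rank

/-! ## 4. … while the positive-degree conclusions hold in it -/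

/-- In `toyModel♭` the conclusions of the trace-free generic theorems hold: `PohlmannSpan` (Thm 3.1, `p ≥ 1`, span
sentence), `Qw8Sufficiency`, `Qw8Milne` — so their hypothesis lists are jointly satisfiable together with `H⁰ = 0`. -/
theorem killH0_positive :
    toyModel.killH0.PohlmannSpan ∧ toyModel.killH0.Qw8Sufficiency ∧ toyModel.killH0.Qw8Milne :=
  ⟨Universe.pohlmannSpan_of_facts killH0_modelAxioms killH0_fact_cupExterior killH0_fact_cup_hodge killH0_fact_pull_H0
      killH0_fact_hodge_F0,
    Universe.qw8Sufficiency_of_descentFacts killH0_modelAxioms killH0_fact_cupExterior killH0_fact_cup_hodge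
      killH0_fact_pull_H0 killH0_fact_hodge_F0 killH0_fact_cupAlg killH0_fact_cupAssoc killH0_fact_gysinDescent
      killH0_fact_dimProd,
    Universe.qw8Milne_of_descentFacts killH0_modelAxioms killH0_fact_cupExterior killH0_fact_cup_hodge
      killH0_fact_pull_H0 killH0_fact_hodge_F0 killH0_fact_cupAlg killH0_fact_cupAssoc killH0_fact_gysinDescent
      killH0_fact_dimProd⟩

/-! ## 5. Independence of the degree-`0` input -/

/-- COR-CM holds in `toyModel♭` (transferred from `toyModel`, `HodgeCM.Model.ToyPerL`). -/
theorem killH0_hc_cm : toyModel.killH0.HC_CM := Universe.KillH0.hc_cm toyModel_hc_cm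

/-- **The degree-`0` input is independent of the trace-free generic facts.**  One universe satisfies `ModelAxioms`,
N1–N4, F4, F5, F7d, `Fact_dimProd` and has `H⁰(X) = 0` for all `X` — so `Fact_H0_rank`, `CMProdH0Nontrivial`,
`CMProdConnected`, F6 and `PohlmannTheorem31All` all fail in it, and no family of degree-`0` classes satisfies the unit law
`1_X ∪ z = z` (so unit classes — qw8-g4's F-H0 — fail as well). -/
theorem degreeZero_independent :
    ∃ U : Universe, (U.ModelAxioms ∧ U.Fact_cupExterior ∧ U.Fact_cup_hodge ∧ U.Fact_pull_H0 ∧ U.Fact_hodge_F0 ∧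
      U.Fact_cupAlg ∧ U.Fact_cupAssoc ∧ U.Fact_gysinDescent ∧ U.Fact_dimProd) ∧
      (∀ X : U.Var, Module.finrank ℚ (U.Coh X 0) = 0) ∧
      (¬ U.Fact_H0_rank ∧ ¬ U.CMProdH0Nontrivial ∧ ¬ U.CMProdConnected ∧ ¬ U.Fact_weightDual ∧
        ¬ U.PohlmannTheorem31All) ∧
      (¬ ∃ one : ∀ X : U.Var, U.Coh X 0, ∀ (X : U.Var) (l : ℕ) (z : U.Coh X l),
        U.cup X 0 l (one X) z = U.castCoh X (Nat.zero_add l).symm z) :=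
  ⟨toyModel.killH0, killH0_descentFacts, killH0_finrank_coh_zero, killH0_degreeZero_fails, killH0_not_unitLaw⟩

/-- **The degree-`0` input is orthogonal to COR-CM.**  `toyModel♭` satisfies the complete trace-free generic list, Pohlmann's
span theorem, [QW8] sufficiency, Milne's step AND the Hodge conjecture for all its CM abelian varieties — while `H⁰ = 0`
everywhere, so that `Fact_H0_rank`, `CMProdH0Nontrivial`, `CMProdConnected`, F6 and Gao–Ullmo Thm 3.1 at `p = 0`
(`PohlmannTheorem31All`) all FAIL.  The degree-`0` input is needed to STATE the all-`p` citation form of Thm 3.1 (and, in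
qw8-g4's presentation, to reduce F7d to F-H0 + F7d-B), never for HC: it is not a hypothesis of `Assembly.COR_CM_of_descentFacts`. -/
theorem degreeZero_orthogonal :
    ∃ U : Universe, (U.ModelAxioms ∧ U.Fact_cupExterior ∧ U.Fact_cup_hodge ∧ U.Fact_pull_H0 ∧ U.Fact_hodge_F0 ∧
      U.Fact_cupAlg ∧ U.Fact_cupAssoc ∧ U.Fact_gysinDescent ∧ U.Fact_dimProd) ∧
      (U.PohlmannSpan ∧ U.Qw8Sufficiency ∧ U.Qw8Milne) ∧ U.HC_CM ∧
      (∀ X : U.Var, Module.finrank ℚ (U.Coh X 0) = 0) ∧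
      (¬ U.Fact_H0_rank ∧ ¬ U.CMProdH0Nontrivial ∧ ¬ U.CMProdConnected ∧ ¬ U.Fact_weightDual ∧
        ¬ U.PohlmannTheorem31All) :=
  ⟨toyModel.killH0, killH0_descentFacts, killH0_positive, killH0_hc_cm, killH0_finrank_coh_zero, killH0_degreeZero_fails⟩

/-- **Non-derivability, pointwise form**: it is NOT the case that every universe with `ModelAxioms`, N1–N4, F4, F5, F7d and
`Fact_dimProd` has `H⁰(A′) ≠ 0` for its CM products (the weakest degree-`0` input, `CMProdH0Nontrivial`). -/
theorem cmProdH0Nontrivial_not_derivable :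
    ¬ ∀ U : Universe, U.ModelAxioms → U.Fact_cupExterior → U.Fact_cup_hodge → U.Fact_pull_H0 → U.Fact_hodge_F0 →
      U.Fact_cupAlg → U.Fact_cupAssoc → U.Fact_gysinDescent → U.Fact_dimProd → U.CMProdH0Nontrivial :=
  fun h => killH0_degreeZero_fails.2.1 (h _ killH0_modelAxioms killH0_fact_cupExterior killH0_fact_cup_hodge
    killH0_fact_pull_H0 killH0_fact_hodge_F0 killH0_fact_cupAlg killH0_fact_cupAssoc killH0_fact_gysinDescent
    killH0_fact_dimProd)

/-- Idem for Gao–Ullmo Thm 3.1 at all `p ≥ 0`: `PohlmannTheorem31All` does not follow from `ModelAxioms` + N1–N4 (+ F4, F5,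
F7d, `Fact_dimProd`), although its `p ≥ 1` part `PohlmannSpan` / `PohlmannTheorem31` does (`pohlmannSpan_of_facts`). -/
theorem pohlmannTheorem31All_not_derivable :
    ¬ ∀ U : Universe, U.ModelAxioms → U.Fact_cupExterior → U.Fact_cup_hodge → U.Fact_pull_H0 → U.Fact_hodge_F0 →
      U.Fact_cupAlg → U.Fact_cupAssoc → U.Fact_gysinDescent → U.Fact_dimProd → U.PohlmannTheorem31All :=
  fun h => killH0_degreeZero_fails.2.2.2.2 (h _ killH0_modelAxioms killH0_fact_cupExterior killH0_fact_cup_hodge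
    killH0_fact_pull_H0 killH0_fact_hodge_F0 killH0_fact_cupAlg killH0_fact_cupAssoc killH0_fact_gysinDescent
    killH0_fact_dimProd)

end HodgeCM.Toy

end
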